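import Mathlib
import Summits.Ventures.PercRepro2.Defs
import Summits.Ventures.PercRepro2.Harris
import Summits.Ventures.PercRepro2.Graph
import Summits.Ventures.PercRepro2.Events
import Summits.Ventures.PercRepro2.CondAvoidPA
import Summits.Ventures.PercRepro2.MixedBoxDefs
import Summits.Ventures.PercRepro2.ReachClosure
import Summits.Ventures.PercRepro2.ReachBits
import Summits.Ventures.PercRepro2.CellMonoRefutation
import Summits.Ventures.PercRepro2.LSMPairRefutation

/-!
# The cross pair does NOT survive the slice `σ_u = N`: the log-supermodular pair `(NST, NTS)` is
FALSE — a kernel-checked refutation (blind cell PercRepro2, mine-1 g51; paper MINE1-LSMPAIRS.md §10)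

The cross pair `m(ST) m(TS) ≤ m(SS) m(TT)` of two observed vertices is a theorem on `{s ↮ t}`
(`BHKAntitoneCross.cross_pair_lsm`).  Its three-vertex version inside the slice `σ_u = N` (`u` in
neither cluster),

  `P(σ = (N,S,T), s↮t) · P(σ = (N,T,S), s↮t) ≤ P(σ = (N,S,S), s↮t) · P(σ = (N,T,T), s↮t)`
  (`LSMPair (1,2,0) (1,0,2)`),

survived 8,000 + 160,000 tropical instances on ≤ 8 and on 11 … 13 vertices and 940 weight climbs
up to ten vertices, and then fell at twelve vertices to the tropical falsifier (kit j333422); the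
witness verified exactly and reduced greedily (kit j333598) contracts to SEVEN vertices and nine
edges: `3–0, 3–4, 1–6, 5–2, 4–1, 0–6, 6–5, 6–3, 2–3` with weights
`1/2, 1/2, 1/2, 1/2, 1/2, 255/256, 1/2, 1/2, 1/4096`; roots `s = 5`, `t = 4`; observed
`(u, v, w) = (0, 2, 1)`.  With the integer weight `wt(ω) = ∏_e (num_e if open else den_e − num_e)`
and `D = ∏_e den_e = 2²⁷`: `m(NST) = 5286906`, `m(NTS) = 1`, `m(NSS) = 16384`, `m(NTT) = 262`
(units of `2⁻²⁷`), so `m(NSS) m(NTT) = 4292608 < 5286906 = m(NST) m(NTS)`.  Mechanism: the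
cell `(N, T, S)` is realised by a SINGLE configuration — `v = 2` reaches `t = 4` only through the
`1/4096`-edge `2–3`, and `u = 0 ∈ N` forces the `255/256`-edge `0–6` closed — while `(N, S, T)`
is common (`v` reaches `s` by the fair edge `5–2`, `w` reaches `t` by `4–1`); the join `(N, S, S)`
and the meet `(N, T, T)` both need `u` cut from the hub `6` AND the rare edge, so their product
is smaller than the product of the two single cells.  Masses decided by the
kernel over the `2⁹` configurations (`ReachBits`); standard axioms; one seat.
-/

namespace Summit.Ventures.PercRepro2

open MixedBox

namespace LSMPairRefutationB

/-- The nine edges of the witness graph on seven vertices. -/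
def ends9 : Fin 9 → Sym2 (Fin 7) :=
  ![s(3, 0), s(3, 4), s(1, 6), s(5, 2), s(4, 1), s(0, 6), s(6, 5), s(6, 3), s(2, 3)]

/-- Numerators of the edge weights. -/
def num9 : Fin 9 → ℕ := ![1, 1, 1, 1, 1, 255, 1, 1, 1]

/-- Denominators of the edge weights. -/
def den9 : Fin 9 → ℕ := ![2, 2, 2, 2, 2, 256, 2, 2, 4096]

/-- The edge weights `1/2, 1/2, 1/2, 1/2, 1/2, 255/256, 1/2, 1/2, 1/4096`. -/
def p9 : Fin 9 → ℚ := fun e => (num9 e : ℚ) / den9 e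

/-- The integer weight of a configuration. -/
def wt9 : Config (Fin 9) → ℕ := fun ω => ∏ e, if ω e then num9 e else den9 e - num9 e

/-- The weights are admissible. -/
lemma p9_isProbVec : IsProbVec p9 :=
  ⟨fun e => by fin_cases e <;> norm_num [p9, num9, den9],
   fun e => by fin_cases e <;> norm_num [p9, num9, den9]⟩

/-- `weight p9 ω = wt9 ω / 2²⁷`. -/
lemma p9_weight_eq (ω : Config (Fin 9)) : weight p9 ω = (wt9 ω : ℚ) / 2 ^ 27 := by
  unfold weight wt9
  have hD : (2 : ℚ) ^ 27 = ∏ e : Fin 9, (den9 e : ℚ) := by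
    simp [Fin.prod_univ_succ, den9]; norm_num
  rw [Nat.cast_prod, hD, ← Finset.prod_div_distrib]
  refine Finset.prod_congr rfl fun e _ => ?_
  fin_cases e <;> cases ω _ <;> norm_num [edgeFactor, p9, num9, den9]

/-- Configurations on nine edges as the numbers below `2⁹`. -/
def e9 : Config (Fin 9) ≃ Fin (2 ^ 9) :=
  (Equiv.piCongrRight fun _ => finTwoEquiv.symm).trans finFunctionFinEquiv

/-- The configuration with bit pattern `k`. -/
def cfg9 (k : Fin (2 ^ 9)) : Config (Fin 9) := e9.symm k

/-- A mass on nine edges as a sum over the `2⁹` bit patterns. -/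
lemma mass_eq_sum9 (wt : Config (Fin 9) → ℕ) (A : Set (Config (Fin 9))) [DecidablePred (· ∈ A)] :
    mass wt A = ∑ k : Fin (2 ^ 9), if cfg9 k ∈ A then wt (cfg9 k) else 0 := by
  rw [mass, Finset.sum_filter]
  exact Fintype.sum_equiv e9 _ _ (fun ω => by simp [cfg9])

/-- The cell `(N, S, T)`. -/
def cNST : Fin 3 × Fin 3 × Fin 3 := (1, 2, 0)
/-- The cell `(N, T, S)`. -/
def cNTS : Fin 3 × Fin 3 × Fin 3 := (1, 0, 2)

set_option maxRecDepth 100000 in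
set_option maxHeartbeats 4000000 in
/-- The integer masses of the witness (roots `5, 4`, observed `0, 2, 1`):
`m(NSS) · m(NTT) = 16384 · 262 < 5286906 · 1 = m(NST) · m(NTS)`. -/
theorem mass_NST_NTS :
    mass wt9 (gridEvent ends9 5 4 0 2 1 {cellJoin cNST cNTS} ∩ boxEvent ends9 5 4 0 2 1 ∅ ∅) *
        mass wt9 (gridEvent ends9 5 4 0 2 1 {cellMeet cNST cNTS} ∩ boxEvent ends9 5 4 0 2 1 ∅ ∅) <
      mass wt9 (gridEvent ends9 5 4 0 2 1 {cNST} ∩ boxEvent ends9 5 4 0 2 1 ∅ ∅) *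
        mass wt9 (gridEvent ends9 5 4 0 2 1 {cNTS} ∩ boxEvent ends9 5 4 0 2 1 ∅ ∅) := by
  rw [mass_eq_sum9, mass_eq_sum9, mass_eq_sum9, mass_eq_sum9]
  decide +kernel

set_option maxRecDepth 100000 in
set_option maxHeartbeats 1000000 in
/-- **The log-supermodular pair `(NST, NTS)` is false**: the cross pair of `(v, w)` does not survive
the conditioning `σ_u = N`. -/
theorem not_lsmPair_NST_NTS : ¬ LSMPair cNST cNTS :=
  LSMPairRefutation.not_lsmPair_of_mass (wt := wt9) (D := 2 ^ 27) p9_isProbVec ends9 5 4 0 2 1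
    (by norm_num) p9_weight_eq cNST cNTS mass_NST_NTS

end LSMPairRefutationB

end Summit.Ventures.PercRepro2
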